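import Summits.Ventures.Crystal3D.Theorems.StickyWulffConstantPolycrystalWulffBoundSingleGrain
import Summits.Ventures.Crystal3D.Theorems.StickyWulffConstantPolycrystalWulffBoundSameLattice
import Literature.Analysis.Convexity.AnisotropicPerimeterUnion

/-!
# `PolycrystalWulffBound` for two grains with the same lattice

Route `StickyWulffConstant` of the venture `Summits/Ventures/Crystal3D`, crux `PolycrystalWulffBound`
(item `stmt-Ventures-19482`). The first case with a WALL: two grains `G₀, G₁` whose frames carry the
same lattice (`A₀(Λ₀) = A₁(Λ₀)`; the crux charges such walls `c ≥ 0` only). Then `W_{A₀} = W_{A₁}`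
(`wulffBody_eq_of_image_eq`), the two exterior energies and the two subtracted interfaces telescope
BY DEFINITION of `ι` into the single anisotropic perimeter `Per_W(G₀ ∪ G₁)`, the wall terms are
nonnegative (`ι_K ≥ 0` = subadditivity, `anisotropicPerimeter_union_le`), and the single-grain Wulff
inequality (`polycrystalWulffBound_singleGrain`) applied to `G₀ ∪ G₁` concludes. Statement = the
crux's `let`-telescope verbatim with `n := 2` and the extra hypothesis `A 0 '' Λ = A 1 '' Λ`.
WHAT THIS IS NOT: anything about grains with DIFFERENT lattices (the content of P).
-/

noncomputable section

namespace Summit.Ventures.Crystal3D.Theorems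

open MeasureTheory Set Metric
open scoped RealInnerProductSpace InnerProductSpace ENNReal
open Literature.MathematicalPhysics.StatisticalMechanics
open Literature.Analysis.Convexity (anisotropicPerimeter anisotropicPerimeter_union_le
  anisotropicPerimeter_le_mul_perimeter perimeter_eq_anisotropicPerimeter_closedBall)

/-- **`PolycrystalWulffBound` for two grains with the same lattice**: the crux's statement
(`let`-telescope verbatim) for `n = 2` grains under the extra hypothesis `A 0 '' Λ = A 1 '' Λ`
(equal lattices — the crux then only asks `c ≥ 0` for their wall). Proof: `W_{A 1} = W_{A 0}`, the
grain energies and subtracted interfaces telescope by the definition of `ι` into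
`Per_{W}(G 0 ∪ G 1)`, the disc-wall terms are `≥ 0` (subadditivity of the `K`-perimeter and
finiteness on sets of finite perimeter), and the single-grain Wulff inequality for `G 0 ∪ G 1`
gives `6·2^{1/3}(√2·Vol)^{2/3} ≤ En`. Unconditional. -/
theorem polycrystalWulffBound_two_sameLattice :
    let Λ : Set (EuclideanSpace ℝ (Fin 3)) := Literature.MathematicalPhysics.StatisticalMechanics.fccStacking 1 (Real.sqrt (2 / 3));
    let Brl : (ℤ → ℤ) → Set (EuclideanSpace ℝ (Fin 3)) := Literature.MathematicalPhysics.StatisticalMechanics.barlowStacking 1 (Real.sqrt (2 / 3));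
    let Ax : EuclideanSpace ℝ (Fin 3) → (EuclideanSpace ℝ (Fin 3) ≃ₗᵢ[ℝ] EuclideanSpace ℝ (Fin 3)) → (EuclideanSpace ℝ (Fin 3) ≃ₗᵢ[ℝ] EuclideanSpace ℝ (Fin 3)) → Prop := fun m A B => ∃ (L : EuclideanSpace ℝ (Fin 3) ≃ₗᵢ[ℝ] EuclideanSpace ℝ (Fin 3)) (s₁ s₂ : EuclideanSpace ℝ (Fin 3)) (σ σ' : ℤ → ℤ), Literature.MathematicalPhysics.StatisticalMechanics.IsHaggSeq σ ∧ Literature.MathematicalPhysics.StatisticalMechanics.IsHaggSeq σ' ∧ L (EuclideanSpace.single (2 : Fin 3) (1 : ℝ)) = m ∧ A '' Λ ⊆ (fun q => L q + s₁) '' Brl σ ∧ B '' Λ ⊆ (fun q => L q + s₂) '' Brl σ';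
    let CoAx : (EuclideanSpace ℝ (Fin 3) ≃ₗᵢ[ℝ] EuclideanSpace ℝ (Fin 3)) → (EuclideanSpace ℝ (Fin 3) ≃ₗᵢ[ℝ] EuclideanSpace ℝ (Fin 3)) → Prop := fun A B => ∃ m, Ax m A B;
    let Φ : EuclideanSpace ℝ (Fin 3) → ℝ := fun ν => Real.sqrt 2 / 4 * ∑ᶠ w ∈ {w ∈ Λ | ‖w‖ = 1}, |⟪w, ν⟫_ℝ|;
    let Per : Set (EuclideanSpace ℝ (Fin 3)) → Set (EuclideanSpace ℝ (Fin 3)) → ℝ := fun K S => (⨆ (ξ : EuclideanSpace ℝ (Fin 3) → EuclideanSpace ℝ (Fin 3)) (_ : ContDiff ℝ 1 ξ ∧ HasCompactSupport ξ ∧ ∀ z, ξ z ∈ K), ENNReal.ofReal (∫ z in S, Literature.MathematicalPhysics.StatisticalMechanics.fieldDivergence ξ z)).toReal;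
    let ι : Set (EuclideanSpace ℝ (Fin 3)) → Set (EuclideanSpace ℝ (Fin 3)) → Set (EuclideanSpace ℝ (Fin 3)) → ℝ := fun K S₁ S₂ => (Per K S₁ + Per K S₂ - Per K (S₁ ∪ S₂)) / 2;
    let W : (EuclideanSpace ℝ (Fin 3) ≃ₗᵢ[ℝ] EuclideanSpace ℝ (Fin 3)) → Set (EuclideanSpace ℝ (Fin 3)) := fun A => {y | ∀ ν : EuclideanSpace ℝ (Fin 3), ⟪y, ν⟫_ℝ ≤ Φ (A.symm ν)};
    let Dsc : EuclideanSpace ℝ (Fin 3) → Set (EuclideanSpace ℝ (Fin 3)) := fun m => {y | ‖y‖ ≤ 1 ∧ ⟪y, m⟫_ℝ = 0};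
    let Tex : (n : ℕ) → (Fin n → Set (EuclideanSpace ℝ (Fin 3))) → (Fin n → (EuclideanSpace ℝ (Fin 3) ≃ₗᵢ[ℝ] EuclideanSpace ℝ (Fin 3))) → (Fin n → Fin n → ℝ) → (Fin n → Fin n → EuclideanSpace ℝ (Fin 3)) → Prop := fun n G A c m => (∀ f : Fin n, Literature.MathematicalPhysics.StatisticalMechanics.HasFinitePerimeter (G f) ∧ volume (G f) < ⊤) ∧ (∀ f g, f ≠ g → Disjoint (G f) (G g)) ∧ (∀ f g, f ≠ g → 0 ≤ c f g) ∧ (∀ f g, f ≠ g → ¬ CoAx (A f) (A g) → m f g = 0 ∧ 1 ≤ c f g) ∧ (∀ f g, f ≠ g → CoAx (A f) (A g) → A f '' Λ ≠ A g '' Λ → Ax (m f g) (A f) (A g) ∧ 1 / 2 ≤ c f g);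
    let En : (n : ℕ) → (Fin n → Set (EuclideanSpace ℝ (Fin 3))) → (Fin n → (EuclideanSpace ℝ (Fin 3) ≃ₗᵢ[ℝ] EuclideanSpace ℝ (Fin 3))) → (Fin n → Fin n → ℝ) → (Fin n → Fin n → EuclideanSpace ℝ (Fin 3)) → ℝ := fun n G A c m => ∑ f : Fin n, Per (W (A f)) (G f) - ∑ f, ∑ g, (if f = g then 0 else ι (W (A f)) (G f) (G g)) + ∑ f, ∑ g, (if f = g then 0 else c f g / 2 * ι (Dsc (m f g)) (G f) (G g));
    let Vol : (n : ℕ) → (Fin n → Set (EuclideanSpace ℝ (Fin 3))) → ℝ := fun n G => (volume (⋃ f : Fin n, G f)).toReal; ∀ (G : Fin 2 → Set (EuclideanSpace ℝ (Fin 3))) (A : Fin 2 → (EuclideanSpace ℝ (Fin 3) ≃ₗᵢ[ℝ] EuclideanSpace ℝ (Fin 3))) (c : Fin 2 → Fin 2 → ℝ) (m : Fin 2 → Fin 2 → EuclideanSpace ℝ (Fin 3)), Tex 2 G A c m → A 0 '' Λ = A 1 '' Λ → 6 * (2 : ℝ) ^ ((1 : ℝ) / 3) * (Real.sqrt 2 *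 Vol 2 G) ^ ((2 : ℝ) / 3) ≤ En 2 G A c m := by
  intro Λ Brl Ax CoAx Φ Per ι W Dsc Tex En Vol G A c m hTex hAA
  obtain ⟨hfin, hdisj, hc0, -, -⟩ := hTex
  have h01 : (0 : Fin 2) ≠ 1 := by decide
  have hd : Disjoint (G 0) (G 1) := hdisj 0 1 h01
  have hW : W (A 1) = W (A 0) := (wulffBody_eq_of_image_eq hAA).symm
  -- finiteness of all perimeters involved
  have hG0 := hfin 0
  have hG1 := hfin 1
  have hUm : MeasurableSet (G 0 ∪ G 1) := hG0.1.1.union hG1.1.1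
  have hUper : perimeter (G 0 ∪ G 1) < ⊤ := by
    rw [perimeter_eq_anisotropicPerimeter_closedBall]
    refine (anisotropicPerimeter_union_le _ hG1.1.1 hd).trans_lt ?_
    rw [← perimeter_eq_anisotropicPerimeter_closedBall, ← perimeter_eq_anisotropicPerimeter_closedBall]
    exact ENNReal.add_lt_top.2 ⟨hG0.1.2, hG1.1.2⟩
  have hUfin : HasFinitePerimeter (G 0 ∪ G 1) := ⟨hUm, hUper⟩
  have hUvol : volume (G 0 ∪ G 1) < ⊤ :=
    (measure_union_le _ _).trans_lt (ENNReal.add_lt_top.2 ⟨hG0.2, hG1.2⟩)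
  -- the disc bodies are bounded, so their perimeters of finite-perimeter sets are finite
  have hDsc : ∀ v : EuclideanSpace ℝ (Fin 3), Dsc v ⊆ closedBall 0 1 := fun v y hy => by
    rw [mem_closedBall, dist_zero_right]; exact hy.1
  have hPfin : ∀ (v : EuclideanSpace ℝ (Fin 3)) {S : Set (EuclideanSpace ℝ (Fin 3))},
      perimeter S < ⊤ → anisotropicPerimeter (Dsc v) S < ⊤ := fun v S hS =>
    (anisotropicPerimeter_le_mul_perimeter one_pos (hDsc v) S).trans_lt
      (ENNReal.mul_lt_top ENNReal.ofReal_lt_top hS)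
  -- nonnegativity of the disc interface terms (subadditivity + finiteness)
  have hι : ∀ (v : EuclideanSpace ℝ (Fin 3)) (S T : Set (EuclideanSpace ℝ (Fin 3))),
      MeasurableSet T → Disjoint S T → perimeter S < ⊤ → perimeter T < ⊤ →
      0 ≤ ι (Dsc v) S T := by
    intro v S T hT hST hS hT'
    show 0 ≤ ((anisotropicPerimeter (Dsc v) S).toReal + (anisotropicPerimeter (Dsc v) T).toReal -
      (anisotropicPerimeter (Dsc v) (S ∪ T)).toReal) / 2
    have hsub := anisotropicPerimeter_union_le (Dsc v) hT hST
    have : (anisotropicPerimeter (Dsc v) (S ∪ T)).toReal ≤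
        (anisotropicPerimeter (Dsc v) S).toReal + (anisotropicPerimeter (Dsc v) T).toReal := by
      rw [← ENNReal.toReal_add (hPfin v hS).ne (hPfin v hT').ne]
      exact ENNReal.toReal_mono (ENNReal.add_ne_top.2 ⟨(hPfin v hS).ne, (hPfin v hT').ne⟩) hsub
    linarith
  -- the energy of the texture
  have hEn : En 2 G A c m = Per (W (A 0)) (G 0 ∪ G 1) +
      (c 0 1 / 2 * ι (Dsc (m 0 1)) (G 0) (G 1) + c 1 0 / 2 * ι (Dsc (m 1 0)) (G 1) (G 0)) := by
    simp only [En, ι, Fin.sum_univ_two, Fin.isValue, if_true, if_false, h01, h01.symm, hW,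
      Set.union_comm (G 1) (G 0)]
    ring
  have hVol : Vol 2 G = (volume (G 0 ∪ G 1)).toReal := by
    show (volume (⋃ f : Fin 2, G f)).toReal = (volume (G 0 ∪ G 1)).toReal
    rw [show (⋃ f : Fin 2, G f) = G 0 ∪ G 1 from by
      ext x; simp [Fin.exists_fin_two]]
  -- assemble
  have hwall : 0 ≤ c 0 1 / 2 * ι (Dsc (m 0 1)) (G 0) (G 1) + c 1 0 / 2 * ι (Dsc (m 1 0)) (G 1) (G 0) := by
    have h1 := hι (m 0 1) (G 0) (G 1) hG1.1.1 hd hG0.1.2 hG1.1.2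
    have h2 := hι (m 1 0) (G 1) (G 0) hG0.1.1 hd.symm hG1.1.2 hG0.1.2
    have hc01 := hc0 0 1 h01
    have hc10 := hc0 1 0 h01.symm
    positivity
  rw [hEn, hVol]
  have hmain := polycrystalWulffBound_singleGrain (A 0) hUfin hUvol
  linarith
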